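import Summits.CriticalPhenomena.Ising3D.IsingColumnFaceL11CensusSegmentLinCands
import Summits.CriticalPhenomena.Ising3D.IsingColumnFaceL11CensusSigmaCellCatalogue

/-!
# The `ALG` census of §7.3 on the certified `Δε` segment as kernel facts, I: an exact root counter for
integer polynomials on a rational interval, and its soundness (cell `pub-ising3x`, seat recog-1)

HONEST FRAMING: lottery ticket; floor = tightest certified 3D Ising CFT bounds; no exact-solution
claim without a proof. Island framing: certified exclusion region at stated derivative order and
assumptions; not a determination of the 3D Ising critical exponents beyond that.

Paper §7.3 prints, for the frozen family `ALG` (real algebraic numbers as DESCRIPTIONS `(P, ξ)`: `P` a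
primitive integer polynomial of degree `d` with positive leading coefficient and height `≤ H_d`,
`(d, H_d) ∈ algTable = [(1,1024), (2,64), (3,12), (4,6), (5,3), (6,2)]`, `ξ` a real root of `P`), the CENSUS
NUMBERS «low-height algebraic numbers 17 867 / 24 584 / 20 260» (descriptions with root in the closed
sub-windows `[81/64, 13/10]`, `[13/10, 27/20]`, `[27/20, 2855/2048]`); §7.1 files them as census numbers,
not theorems. The companions `…SegmentAlg.lean` / `…SegmentAlgA/B.lean` make them KERNEL FACTS; this
module supplies the one new ingredient, an EXACT ROOT COUNTER evaluated by the kernel: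
* `signTestQ` (the scaled-integer interval-Horner enclosure `encloseZ` of `ExclusionSentencesAlgCore`
  excludes `0` on `[a, b]`: no root), `monoTestQ` (the enclosure of the formal derivative `polyDerivL` is positive or
  negative: `evalL c` is strictly monotone on `[a, b]`, hence has at most one root
  there, and exactly one iff `c(a) = 0`, `c(b) = 0` or `c(a)`, `c(b)` have opposite signs — exact rational
  evaluation `evalQ`), `rootLeaf` (tests may run on a superset cell with small denominators — a kernel-cost device),
  `rootCount c n a b` = bisection to depth `n` with the exact correction for a root AT a bisection point,
  `rootCountS`;
* SOUNDNESS `rootCount_sound`: `rootCount c n a b = some m` ⇒ the set of real roots of `c` in `[a, b]` is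
  finite with exactly `m` elements (intermediate value theorem, strict monotonicity from the sign of the
  derivative — `strictMonoOn_evalL_of_posTestQ` of the σ-cell catalogue module —, and
  `Set.ncard_union_add_ncard_inter` at each bisection).
A polynomial with a multiple root in the interval is never decided (the derivative vanishes there); the
census module handles the two such table polynomials by exact square certificates. Generic; nothing here
mentions the 3D Ising model; no certificate, no datum, no axiom.
lottery ticket; floor = tightest certified 3D Ising CFT bounds; no exact-solution claim without a proof.
-/

namespace Summit.CriticalPhenomena.Ising3D
namespace ColumnFaceL11
open Set Literature.MathematicalPhysics.QuantumFieldTheory.ConformalBootstrap3D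

/-! ### Tests on a rational interval `[a, b] ⊂ [0, ∞)` -/

/-- The scaled frame of a rational window `[a, b]`: `(LO, HI, M)` with `x·M ∈ [LO, HI]` for `x ∈ [a, b]`
(as in `algExcluded` / `posTestQ`). [folklore] -/
def qFrame (a b : ℚ) : ℤ × ℤ × ℤ := (a.num * b.den, b.num * a.den, (a.den : ℤ) * b.den)

/-- From the frame: `x ∈ [a, b]` (`0 ≤ a`) gives `LO ≤ x·M ≤ HI` with `0 ≤ LO`, `0 < M`. [folklore] -/
theorem qFrame_spec {a b : ℚ} (ha : 0 ≤ a) {x : ℝ} (hx : (a : ℝ) ≤ x ∧ x ≤ b) :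
    0 ≤ (qFrame a b).1 ∧ 0 < (qFrame a b).2.2 ∧ (((qFrame a b).1 : ℤ) : ℝ) ≤ x * (((qFrame a b).2.2 : ℤ) : ℝ) ∧
      x * (((qFrame a b).2.2 : ℤ) : ℝ) ≤ (((qFrame a b).2.1 : ℤ) : ℝ) := by
  simp only [qFrame]
  have hM : (0 : ℤ) < (a.den : ℤ) * b.den := by exact_mod_cast Nat.mul_pos a.den_pos b.den_pos
  have hLO : (0 : ℤ) ≤ a.num * b.den := mul_nonneg (Rat.num_nonneg.mpr ha) (Int.natCast_nonneg _)
  have hprod : (0 : ℝ) ≤ (a.den : ℝ) * b.den := by positivity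
  refine ⟨hLO, hM, ?_, ?_⟩
  · push_cast; rw [← ratCast_mul_den a]
    calc (a : ℝ) * a.den * b.den = a * (a.den * b.den) := by ring
      _ ≤ x * (a.den * b.den) := mul_le_mul_of_nonneg_right hx.1 hprod
  · push_cast; rw [← ratCast_mul_den b]
    calc x * ((a.den : ℝ) * b.den) ≤ b * (a.den * b.den) := mul_le_mul_of_nonneg_right hx.2 hprod
      _ = (b : ℝ) * b.den * a.den := by ring

/-- The scaled-integer enclosure of `c` on `[a, b]` (ONE interval-Horner pass gives both bounds). [folklore] -/
def enclQ (c : List ℤ) (a b : ℚ) : ℤ × ℤ × ℤ := encloseZ (qFrame a b).1 (qFrame a b).2.1 (qFrame a b).2.2 c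

/-- Lower bound positive ⇒ `evalL c > 0` on `[a, b]`. [folklore] -/
theorem evalL_pos_of_enclQ {c : List ℤ} {a b : ℚ} (ha : 0 ≤ a) (h : 0 < (enclQ c a b).1) {x : ℝ}
    (hx : (a : ℝ) ≤ x ∧ x ≤ b) : 0 < evalL c x := by
  obtain ⟨hLO, hM, hlo, hhi⟩ := qFrame_spec ha hx
  obtain ⟨h1, -, hN⟩ := encloseZ_sound hLO hM hlo hhi c
  have hN' : (0 : ℝ) < (enclQ c a b).2.2 := by exact_mod_cast hN
  have hU' : (0 : ℝ) < (enclQ c a b).1 := by exact_mod_cast h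
  have h1' : ((enclQ c a b).1 : ℝ) ≤ evalL c x * (enclQ c a b).2.2 := h1
  by_contra hle
  have := mul_nonpos_iff.mpr (Or.inr ⟨not_lt.mp hle, hN'.le⟩)
  linarith

/-- Upper bound negative ⇒ `evalL c < 0` on `[a, b]`. [folklore] -/
theorem evalL_neg_of_enclQ {c : List ℤ} {a b : ℚ} (ha : 0 ≤ a) (h : (enclQ c a b).2.1 < 0) {x : ℝ}
    (hx : (a : ℝ) ≤ x ∧ x ≤ b) : evalL c x < 0 := by
  obtain ⟨hLO, hM, hlo, hhi⟩ := qFrame_spec ha hx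
  obtain ⟨-, h2, hN⟩ := encloseZ_sound hLO hM hlo hhi c
  have hN' : (0 : ℝ) < (enclQ c a b).2.2 := by exact_mod_cast hN
  have hV' : ((enclQ c a b).2.1 : ℝ) < 0 := by exact_mod_cast h
  have h2' : evalL c x * (enclQ c a b).2.2 ≤ ((enclQ c a b).2.1 : ℝ) := h2
  by_contra hle
  have := mul_nonneg (not_lt.mp hle) hN'.le
  linarith

/-- Sign-exclusion test: the enclosure of `c` on `[a, b]` is positive or negative. [folklore] -/
def signTestQ (c : List ℤ) (a b : ℚ) : Bool :=
  decide (0 ≤ a) && (decide (0 < (enclQ c a b).1) || decide ((enclQ c a b).2.1 < 0))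

/-- Soundness of `signTestQ`: no root in `[a, b]`. [folklore] -/
theorem evalL_ne_zero_of_signTestQ {c : List ℤ} {a b : ℚ} (h : signTestQ c a b = true) {x : ℝ}
    (hx : (a : ℝ) ≤ x ∧ x ≤ b) : evalL c x ≠ 0 := by
  simp only [signTestQ, Bool.and_eq_true, Bool.or_eq_true, decide_eq_true_eq] at h
  rcases h.2 with h2 | h2
  · exact (evalL_pos_of_enclQ h.1 h2 hx).ne'
  · exact (evalL_neg_of_enclQ h.1 h2 hx).ne

/-- Monotonicity test: the enclosure of the formal derivative of `c` on `[a, b]` is positive or negative.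
[folklore] -/
def monoTestQ (c : List ℤ) (a b : ℚ) : Bool :=
  decide (0 ≤ a) &&
    (decide (0 < (enclQ (polyDerivL c) a b).1) || decide ((enclQ (polyDerivL c) a b).2.1 < 0))

/-- Soundness of `monoTestQ`: `evalL c` is strictly monotone or strictly antitone on `[a, b]`. [folklore] -/
theorem mono_of_monoTestQ {c : List ℤ} {a b : ℚ} (h : monoTestQ c a b = true) :
    StrictMonoOn (evalL c) (Icc (a : ℝ) b) ∨ StrictAntiOn (evalL c) (Icc (a : ℝ) b) := by
  simp only [monoTestQ, Bool.and_eq_true, Bool.or_eq_true, decide_eq_true_eq] at h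
  rcases h.2 with h2 | h2
  · left
    exact strictMonoOn_of_deriv_pos (convex_Icc _ _) (continuous_evalL c).continuousOn fun x hx => by
      rw [(hasDerivAt_evalL c x).deriv]
      have hx' := interior_subset hx
      exact evalL_pos_of_enclQ h.1 h2 ⟨hx'.1, hx'.2⟩
  · right
    exact strictAntiOn_of_deriv_neg (convex_Icc _ _) (continuous_evalL c).continuousOn fun x hx => by
      rw [(hasDerivAt_evalL c x).deriv]
      have hx' := interior_subset hx
      exact evalL_neg_of_enclQ h.1 h2 ⟨hx'.1, hx'.2⟩

/-- The roots of `c` in the closed real interval `[a, b]`. [folklore] -/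
def rootsIn (c : List ℤ) (a b : ℚ) : Set ℝ := {x : ℝ | (a : ℝ) ≤ x ∧ x ≤ b ∧ evalL c x = 0}

/-- On a monotone cell: exactly one root iff `c(a) = 0`, `c(b) = 0`, or `c(a)`, `c(b)` have opposite strict
signs (exact rational evaluation). [folklore] -/
def rootHere (c : List ℤ) (a b : ℚ) : ℕ :=
  if evalQ c a = 0 ∨ evalQ c b = 0 ∨ ¬(evalQ c a < 0 ↔ evalQ c b < 0) then 1 else 0

/-- The leaf decision for the cell `[a, b]`, with the two enclosure tests run on a SUPERSET cell `[aS, bS]`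
(a kernel-cost device: a superset with small denominators keeps the scaled integers small; inside the
bisection `aS = a`, `bS = b`): `some 0` by the sign test, `some (rootHere c a b)` by the monotonicity test,
else undecided. [folklore] -/
def rootLeaf (c : List ℤ) (aS bS a b : ℚ) : Option ℕ :=
  if signTestQ c aS bS then some 0 else if monoTestQ c aS bS then some (rootHere c a b) else none

/-- **The root counter**: bisection to depth `n` over the leaf decision, subtracting `1` when the bisection
point itself is a root (it is counted in both halves). `none` = undecided. [folklore] -/
def rootCount (c : List ℤ) : ℕ → ℚ → ℚ → Option ℕ
  | 0, a, b => rootLeaf c a b a b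
  | n + 1, a, b =>
    match rootLeaf c a b a b with
    | some m => some m
    | none =>
      match rootCount c n a ((a + b) / 2), rootCount c n ((a + b) / 2) b with
      | some n1, some n2 => some (n1 + n2 - if evalQ c ((a + b) / 2) = 0 then 1 else 0)
      | _, _ => none

/-! ### Soundness -/

/-- `evalL c r = 0 ↔ evalQ c r = 0` at a rational point. [folklore] -/
theorem evalL_eq_zero_iff_evalQ (c : List ℤ) (r : ℚ) : evalL c (r : ℝ) = 0 ↔ evalQ c r = 0 := by
  rw [evalL_ratCast]; exact_mod_cast Iff.rfl

/-- `evalL c r < 0 ↔ evalQ c r < 0` at a rational point. [folklore] -/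
theorem evalL_neg_iff_evalQ (c : List ℤ) (r : ℚ) : evalL c (r : ℝ) < 0 ↔ evalQ c r < 0 := by
  rw [evalL_ratCast]; exact_mod_cast Iff.rfl

/-- Soundness of the leaf decision (`[a, b] ⊆ [aS, bS]`). [folklore] -/
theorem rootLeaf_sound {c : List ℤ} {aS bS a b : ℚ} (haS : aS ≤ a) (hab : a ≤ b) (hbS : b ≤ bS) {m : ℕ}
    (h : rootLeaf c aS bS a b = some m) : (rootsIn c a b).Finite ∧ (rootsIn c a b).ncard = m := by
  have haS' : ((aS : ℚ) : ℝ) ≤ a := Rat.cast_le.mpr haS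
  have hbS' : ((b : ℚ) : ℝ) ≤ bS := Rat.cast_le.mpr hbS
  have hsubI : Icc (a : ℝ) b ⊆ Icc (aS : ℝ) bS := Set.Icc_subset_Icc haS' hbS'
  unfold rootLeaf at h
  split_ifs at h with hs hm
  · -- sign test: no root
    obtain rfl := Option.some.inj h
    have he : rootsIn c a b = ∅ := Set.eq_empty_iff_forall_notMem.mpr fun x hx =>
      evalL_ne_zero_of_signTestQ hs ⟨haS'.trans hx.1, hx.2.1.trans hbS'⟩ hx.2.2
    rw [he]; exact ⟨Set.finite_empty, Set.ncard_empty _⟩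
  · -- monotone: at most one root
    have hval := Option.some.inj h
    have hmono : StrictMonoOn (evalL c) (Icc (a : ℝ) b) ∨ StrictAntiOn (evalL c) (Icc (a : ℝ) b) := by
      rcases mono_of_monoTestQ hm with h1 | h1
      · exact Or.inl (h1.mono hsubI)
      · exact Or.inr (h1.mono hsubI)
    have hsub : (rootsIn c a b).Subsingleton := by
      intro x hx y hy
      have hxI : x ∈ Icc (a : ℝ) b := ⟨hx.1, hx.2.1⟩
      have hyI : y ∈ Icc (a : ℝ) b := ⟨hy.1, hy.2.1⟩
      have hfx : evalL c x = evalL c y := by rw [hx.2.2, hy.2.2]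
      rcases hmono with hmono | hmono
      · exact hmono.injOn hxI hyI hfx
      · exact hmono.injOn hxI hyI hfx
    refine ⟨hsub.finite, ?_⟩
    have hab' : ((a : ℚ) : ℝ) ≤ b := Rat.cast_le.mpr hab
    have haI : ((a : ℚ) : ℝ) ∈ Icc (a : ℝ) b := ⟨le_rfl, hab'⟩
    have hbI : ((b : ℚ) : ℝ) ∈ Icc (a : ℝ) b := ⟨hab', le_rfl⟩
    rw [← hval]
    unfold rootHere
    by_cases hcond : evalQ c a = 0 ∨ evalQ c b = 0 ∨ ¬(evalQ c a < 0 ↔ evalQ c b < 0)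
    · rw [if_pos hcond]
      -- a root exists
      obtain ⟨x, hx⟩ : ∃ x, x ∈ rootsIn c a b := by
        rcases hcond with h0 | h0 | h0
        · exact ⟨a, le_rfl, hab', (evalL_eq_zero_iff_evalQ c a).mpr h0⟩
        · exact ⟨b, hab', le_rfl, (evalL_eq_zero_iff_evalQ c b).mpr h0⟩
        · -- opposite strict signs: intermediate value theorem
          rw [not_iff] at h0
          by_cases ha0 : evalQ c a < 0
          · have hb0 : ¬evalQ c b < 0 := fun hb => (h0.mpr hb) ha0
            have hfa : evalL c (a : ℝ) < 0 := (evalL_neg_iff_evalQ c a).mpr ha0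
            have hfb : 0 ≤ evalL c (b : ℝ) := by
              rw [evalL_ratCast]; exact_mod_cast not_lt.mp hb0
            obtain ⟨x, hx, hx0⟩ := intermediate_value_Icc hab' (continuous_evalL c).continuousOn
              (show (0 : ℝ) ∈ Icc (evalL c (a : ℝ)) (evalL c (b : ℝ)) from ⟨hfa.le, hfb⟩)
            exact ⟨x, hx.1, hx.2, hx0⟩
          · have hb0 : evalQ c b < 0 := h0.mp ha0
            have hfb : evalL c (b : ℝ) < 0 := (evalL_neg_iff_evalQ c b).mpr hb0
            have hfa : 0 ≤ evalL c (a : ℝ) := by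
              rw [evalL_ratCast]; exact_mod_cast not_lt.mp ha0
            obtain ⟨x, hx, hx0⟩ := intermediate_value_Icc' hab' (continuous_evalL c).continuousOn
              (show (0 : ℝ) ∈ Icc (evalL c (b : ℝ)) (evalL c (a : ℝ)) from ⟨hfb.le, hfa⟩)
            exact ⟨x, hx.1, hx.2, hx0⟩
      exact Set.ncard_eq_one.mpr ⟨x, hsub.eq_singleton_of_mem hx⟩
    · rw [if_neg hcond]
      simp only [not_or, not_not] at hcond
      obtain ⟨ha0, hb0, hiff⟩ := hcond
      have he : rootsIn c a b = ∅ := by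
        refine Set.eq_empty_iff_forall_notMem.mpr fun x hx => ?_
        have hxI : x ∈ Icc (a : ℝ) b := ⟨hx.1, hx.2.1⟩
        have hfa : evalL c (a : ℝ) ≠ 0 := fun h => ha0 ((evalL_eq_zero_iff_evalQ c a).mp h)
        have hfb : evalL c (b : ℝ) ≠ 0 := fun h => hb0 ((evalL_eq_zero_iff_evalQ c b).mp h)
        rcases hmono with hmono | hmono
        · have h1 : evalL c (a : ℝ) ≤ evalL c x := hmono.monotoneOn haI hxI hx.1
          have h2 : evalL c x ≤ evalL c (b : ℝ) := hmono.monotoneOn hxI hbI hx.2.1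
          rw [hx.2.2] at h1 h2
          have hfa' : evalL c (a : ℝ) < 0 := lt_of_le_of_ne h1 hfa
          have hfb' : ¬evalL c (b : ℝ) < 0 := not_lt.mpr h2
          exact hfb' ((evalL_neg_iff_evalQ c b).mpr (hiff.mp ((evalL_neg_iff_evalQ c a).mp hfa')))
        · have h1 : evalL c x ≤ evalL c (a : ℝ) := hmono.antitoneOn haI hxI hx.1
          have h2 : evalL c (b : ℝ) ≤ evalL c x := hmono.antitoneOn hxI hbI hx.2.1
          rw [hx.2.2] at h1 h2
          have hfb' : evalL c (b : ℝ) < 0 := lt_of_le_of_ne h2 hfb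
          have hfa' : ¬evalL c (a : ℝ) < 0 := not_lt.mpr h1
          exact hfa' ((evalL_neg_iff_evalQ c a).mpr (hiff.mpr ((evalL_neg_iff_evalQ c b).mp hfb')))
      rw [he]; exact Set.ncard_empty _

/-- **Soundness of the root counter.** `rootCount c n a b = some m` (`a ≤ b`) ⇒ the set of real roots of `c`
in `[a, b]` is finite and has exactly `m` elements. [folklore] -/
theorem rootCount_sound (c : List ℤ) : ∀ (n : ℕ) {a b : ℚ} (_ : a ≤ b) {m : ℕ},
    rootCount c n a b = some m → (rootsIn c a b).Finite ∧ (rootsIn c a b).ncard = m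
  | 0, a, b, hab, m, h => rootLeaf_sound le_rfl hab le_rfl (by simpa [rootCount] using h)
  | n + 1, a, b, hab, m, h => by
      cases hleaf : rootLeaf c a b a b with
      | some m' =>
        simp only [rootCount, hleaf, Option.some.injEq] at h
        subst h
        exact rootLeaf_sound le_rfl hab le_rfl hleaf
      | none =>
        cases h1 : rootCount c n a ((a + b) / 2) with
        | none => simp [rootCount, hleaf, h1] at h
        | some n1 =>
          cases h2 : rootCount c n ((a + b) / 2) b with
          | none => simp [rootCount, hleaf, h1, h2] at h
          | some n2 =>
            simp only [rootCount, hleaf, h1, h2, Option.some.injEq] at h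
            set md : ℚ := (a + b) / 2 with hmd
            have ham : a ≤ md := by rw [hmd]; linarith
            have hmb : md ≤ b := by rw [hmd]; linarith
            obtain ⟨hf1, hc1⟩ := rootCount_sound c n ham h1
            obtain ⟨hf2, hc2⟩ := rootCount_sound c n hmb h2
            have ham' : ((a : ℚ) : ℝ) ≤ md := Rat.cast_le.mpr ham
            have hmb' : ((md : ℚ) : ℝ) ≤ b := Rat.cast_le.mpr hmb
            have hU : rootsIn c a b = rootsIn c a md ∪ rootsIn c md b := by
              ext x
              simp only [rootsIn, Set.mem_setOf_eq, Set.mem_union]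
              constructor
              · rintro ⟨h1, h2, h3⟩
                rcases le_total x (md : ℝ) with hx | hx
                · exact Or.inl ⟨h1, hx, h3⟩
                · exact Or.inr ⟨hx, h2, h3⟩
              · rintro (⟨h1, h2, h3⟩ | ⟨h1, h2, h3⟩)
                · exact ⟨h1, h2.trans hmb', h3⟩
                · exact ⟨ham'.trans h1, h2, h3⟩
            have hI : rootsIn c a md ∩ rootsIn c md b = {x | x = (md : ℝ) ∧ evalL c (md : ℝ) = 0} := by
              ext x
              simp only [rootsIn, Set.mem_setOf_eq, Set.mem_inter_iff]
              constructor
              · rintro ⟨⟨-, h2, h3⟩, ⟨h4, -, -⟩⟩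
                have hx : x = md := le_antisymm h2 h4
                exact ⟨hx, hx ▸ h3⟩
              · rintro ⟨rfl, h0⟩
                exact ⟨⟨ham', le_rfl, h0⟩, ⟨le_rfl, hmb', h0⟩⟩
            have hadd := Set.ncard_union_add_ncard_inter (rootsIn c a md) (rootsIn c md b) hf1 hf2
            rw [← hU, hI, hc1, hc2] at hadd
            refine ⟨by rw [hU]; exact hf1.union hf2, ?_⟩
            by_cases h0 : evalQ c md = 0
            · have h0' : evalL c (md : ℝ) = 0 := (evalL_eq_zero_iff_evalQ c md).mpr h0
              have hs : {x : ℝ | x = (md : ℝ) ∧ evalL c (md : ℝ) = 0} = {(md : ℝ)} := by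
                ext x; simp [h0']
              rw [hs, Set.ncard_singleton] at hadd
              rw [if_pos h0] at h
              omega
            · have hs : {x : ℝ | x = (md : ℝ) ∧ evalL c (md : ℝ) = 0} = ∅ :=
                Set.eq_empty_iff_forall_notMem.mpr fun x hx => h0 ((evalL_eq_zero_iff_evalQ c md).mp hx.2)
              rw [hs, Set.ncard_empty] at hadd
              rw [if_neg h0] at h
              omega

/-- The root counter with the first leaf decision taken on a superset cell `[aS, bS] ⊇ [a, b]` (small
denominators), then bisection on the exact cell. [folklore] -/
def rootCountS (c : List ℤ) (aS bS a b : ℚ) : Option ℕ :=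
  match rootLeaf c aS bS a b with
  | some m => some m
  | none => rootCount c 40 a b

/-- Soundness of `rootCountS`. [folklore] -/
theorem rootCountS_sound {c : List ℤ} {aS bS a b : ℚ} (haS : aS ≤ a) (hab : a ≤ b) (hbS : b ≤ bS) {m : ℕ}
    (h : rootCountS c aS bS a b = some m) : (rootsIn c a b).Finite ∧ (rootsIn c a b).ncard = m := by
  unfold rootCountS at h
  split at h
  · rename_i m' hleaf
    obtain rfl := Option.some.inj h
    exact rootLeaf_sound haS hab hbS hleaf
  · exact rootCount_sound c 40 hab h

/-- The roots of a perfect square `g·g` are the roots of `g`. [folklore] -/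
theorem rootsIn_polyMul_self (g : List ℤ) (a b : ℚ) : rootsIn (polyMul g g) a b = rootsIn g a b := by
  ext x
  simp only [rootsIn, Set.mem_setOf_eq, evalL_polyMul, mul_self_eq_zero]

end ColumnFaceL11
end Summit.CriticalPhenomena.Ising3D
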